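import Literature.NumberTheory.EllipticCurves.HeckeOnManinSymbolsBoundary
import Literature.NumberTheory.EllipticCurves.HeckeTraceLinearAlgebra
import Literature.NumberTheory.EllipticCurves.HeckeTnGamma0TraceReal
import Literature.NumberTheory.EllipticCurves.ModularFormsGamma0Genus
import HarnessLib

/-!
# The trace of `T_n` on `S₂(Γ₀(N))` through M-symbols (Popa–Zagier / Popa)

Let `V = ℚ^X`, `X = SL₂(ℤ)/Γ₀(N)`, with the M-symbol map `Ψ : V → S₂(Γ₀(N))^∧` and the boundary map
`δ : V → ℚ^{cusps}` of `ModularSymbolsManin`.  For a finitely supported `ξ : M₂(ℤ) → ℚ` on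
matrices of determinant `n`, `(n, N) = 1`, Popa's operator (Popa 2018, §2 "The proof")
`𝔗_ξ(e_q) = ½ ∑_M ξ(M) e_{q · adj M}` (`heckeV`; the `½` because our `ξ` lives on matrices rather
than on `M₂(ℤ)/±1`) satisfies

* `Ψ ∘ 𝔗_ξ = T_n^* ∘ Ψ` when `ξ` has property (A) (`msymbolMap_heckeV`, from
  `finsum_smul_msymbol_eq`);
* `𝔗_ξ` maps `range(1 + S^*)` into `range(1 + (TS)^* + (TS)^{*2})` and vice versa when `ξ` has
  property (B) (`heckeV_mem_range_relThree`, `heckeV_mem_range_relTwo`: Popa–Zagier 2017, proof of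
  Lemma 5), so that by the swap lemma `tr(𝔗_ξ | Rel) = tr(𝔗_ξ | ℚ·𝟙) = ½ ∑_M ξ(M)`
  (`trace_heckeV_relModule`);
* `tr(𝔗_ξ | V) = ½ ∑_M ξ(M) · #{q : q · adj M = q}` (`trace_heckeV`).

## References
* [Popa2014] A. Popa, *On the trace formula for Hecke operators on congruence subgroups, II*,
  Res. Math. Sci. 5 (2018), §2.
* [PopaZagier2017] A. Popa, D. Zagier, *A combinatorial refinement of the Kronecker–Hurwitz class
  number relation*, Proc. AMS 145 (2017), Lemma 5 and §5.
* [CremonaAlgorithms1997] J. E. Cremona, *Algorithms for modular elliptic curves*, §2.1–2.2.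
-/

noncomputable section

open scoped MatrixGroups ModularForm Classical
open CongruenceSubgroup ModularGroup
open Literature.NumberTheory.Automorphic.PopaZagier

namespace Literature.NumberTheory.EllipticCurves.ModularForms

/-! ### Reindexing equivalences of `M₂(ℤ)` -/

/-- Right multiplication by an invertible integer matrix, as a self-equivalence of `M₂(ℤ)`. [folklore] -/
def mulRightEquiv (A B : Matrix (Fin 2) (Fin 2) ℤ) (hAB : A * B = 1) (hBA : B * A = 1) :
    Matrix (Fin 2) (Fin 2) ℤ ≃ Matrix (Fin 2) (Fin 2) ℤ where
  toFun M := M * A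
  invFun M := M * B
  left_inv M := by simp only [Matrix.mul_assoc, hAB, Matrix.mul_one]
  right_inv M := by simp only [Matrix.mul_assoc, hBA, Matrix.mul_one]

/-- Left multiplication by an invertible integer matrix, as a self-equivalence of `M₂(ℤ)`. [folklore] -/
def mulLeftEquiv (A B : Matrix (Fin 2) (Fin 2) ℤ) (hAB : A * B = 1) (hBA : B * A = 1) :
    Matrix (Fin 2) (Fin 2) ℤ ≃ Matrix (Fin 2) (Fin 2) ℤ where
  toFun M := A * M
  invFun M := B * M
  left_inv M := by simp only [← Matrix.mul_assoc, hBA, Matrix.one_mul]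
  right_inv M := by simp only [← Matrix.mul_assoc, hAB, Matrix.one_mul]

/-- Unfolding `mulRightEquiv`. [folklore] -/
@[simp] theorem mulRightEquiv_apply (A B : Matrix (Fin 2) (Fin 2) ℤ) (hAB : A * B = 1) (hBA : B * A = 1)
    (M : Matrix (Fin 2) (Fin 2) ℤ) : mulRightEquiv A B hAB hBA M = M * A := rfl

/-- Unfolding `mulLeftEquiv`. [folklore] -/
@[simp] theorem mulLeftEquiv_apply (A B : Matrix (Fin 2) (Fin 2) ℤ) (hAB : A * B = 1) (hBA : B * A = 1)
    (M : Matrix (Fin 2) (Fin 2) ℤ) : mulLeftEquiv A B hAB hBA M = A * M := rfl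

/-- `S (-S) = 1`. [folklore] -/
theorem matS_mul_neg_matS : matS * -matS = 1 := by
  rw [Matrix.mul_neg, matS_mul_matS, neg_neg]

/-- `(-S) S = 1`. [folklore] -/
theorem neg_matS_mul_matS : -matS * matS = 1 := by
  rw [Matrix.neg_mul, matS_mul_matS, neg_neg]

/-- `adj U = U⁻¹`: `U · adj U = 1`. [folklore] -/
theorem matU_mul_adjugate : matU * Matrix.adjugate matU = 1 := by
  rw [Matrix.mul_adjugate, det_matU, one_smul]

/-- `adj U · U = 1`. [folklore] -/
theorem adjugate_mul_matU : Matrix.adjugate matU * matU = 1 := by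
  rw [Matrix.adjugate_mul, det_matU, one_smul]

/-- `adj (adj A) = A` for `2 × 2` matrices. [folklore] -/
theorem adjugate_adjugate_two (A : Matrix (Fin 2) (Fin 2) ℤ) : Matrix.adjugate (Matrix.adjugate A) = A := by
  ext i j; fin_cases i <;> fin_cases j <;> simp [Matrix.adjugate_fin_two]

/-- `↑(T S) = matU`. [folklore] -/
theorem coe_T_mul_S_eq_matU : ((T * S : SL(2, ℤ)) : Matrix (Fin 2) (Fin 2) ℤ) = matU := by
  rw [Matrix.SpecialLinearGroup.coe_mul, ModularGroup.T, ModularGroup.S, matU]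
  ext i j; fin_cases i <;> fin_cases j <;> rfl

/-- A linear map commutes with finitely supported `finsum`s. [folklore] -/
theorem map_finsum_linearMap {R M M₂ ι : Type*} [Semiring R] [AddCommMonoid M] [AddCommMonoid M₂]
    [Module R M] [Module R M₂] (f : M →ₗ[R] M₂) {g : ι → M} (hg : Function.HasFiniteSupport g) :
    f (∑ᶠ i, g i) = ∑ᶠ i, f (g i) :=
  f.toAddMonoidHom.map_finsum hg

variable {N : ℕ} [NeZero N]

/-! ### Popa's operator `𝔗_ξ` on `V = ℚ^X` -/

variable (N) in
/-- **Popa's operator on `V = ℚ^X`**: `𝔗_ξ(e_q) = ½ ∑_M ξ(M) e_{q · adj M}`, where `q · B` is the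
right action `actP` of integer matrices of determinant prime to `N` on `X = SL₂(ℤ)/Γ₀(N) ≅ ℙ¹(ℤ/N)`
(Popa 2018, §2: `V = ℚ[𝓜_n]^Γ ≅ Maps(Γ\𝓜_n, ℚ)` with `T̃_n` acting on the left).
[cite: Popa2014, §2 "The proof"] -/
def heckeV (ξ : Matrix (Fin 2) (Fin 2) ℤ → ℚ) : (Gamma0Coset N → ℚ) →ₗ[ℚ] (Gamma0Coset N → ℚ) :=
  (Pi.basisFun ℚ (Gamma0Coset N)).constr ℚ fun q =>
    (1 / 2 : ℚ) • ∑ᶠ M : Matrix (Fin 2) (Fin 2) ℤ,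
      ξ M • (Pi.single (actP N q (Matrix.adjugate M)) (1 : ℚ) : Gamma0Coset N → ℚ)

/-- `𝔗_ξ` on a basis vector. [cite: Popa2014, §2] -/
theorem heckeV_single (ξ : Matrix (Fin 2) (Fin 2) ℤ → ℚ) (q : Gamma0Coset N) :
    heckeV N ξ (Pi.single q 1) = (1 / 2 : ℚ) • ∑ᶠ M : Matrix (Fin 2) (Fin 2) ℤ,
      ξ M • (Pi.single (actP N q (Matrix.adjugate M)) (1 : ℚ) : Gamma0Coset N → ℚ) := by
  rw [heckeV, ← Pi.basisFun_apply, Module.Basis.constr_basis]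

/-- Finiteness of the summands of `𝔗_ξ`. [folklore] -/
theorem finite_support_smul_of_finite {ξ : Matrix (Fin 2) (Fin 2) ℤ → ℚ}
    (hfin : (Function.support ξ).Finite) {A : Type*} [AddCommGroup A] [Module ℚ A]
    (W : Matrix (Fin 2) (Fin 2) ℤ → A) : Function.HasFiniteSupport fun M => ξ M • W M :=
  hfin.subset (Function.support_smul_subset_left _ _)

/-- `𝔗_ξ` on a basis vector, as a finite sum over any finite set containing the support. [folklore] -/
theorem heckeV_single_eq_sum {ξ : Matrix (Fin 2) (Fin 2) ℤ → ℚ} {s : Finset (Matrix (Fin 2) (Fin 2) ℤ)}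
    (hs : Function.support ξ ⊆ s) (q : Gamma0Coset N) :
    heckeV N ξ (Pi.single q 1) = (1 / 2 : ℚ) • ∑ M ∈ s,
      ξ M • (Pi.single (actP N q (Matrix.adjugate M)) (1 : ℚ) : Gamma0Coset N → ℚ) := by
  rw [heckeV_single, finsum_eq_sum_of_support_subset]
  exact (Function.support_smul_subset_left _ _).trans hs

/-- **`tr(𝔗_ξ | V) = ½ ∑_M ξ(M) · #{q : q · adj M = q}`** (the diagonal of a weighted sum of
permutation matrices). [cite: Popa2014, §2 "The proof"] -/
theorem trace_heckeV {ξ : Matrix (Fin 2) (Fin 2) ℤ → ℚ} {s : Finset (Matrix (Fin 2) (Fin 2) ℤ)}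
    (hs : Function.support ξ ⊆ s) :
    LinearMap.trace ℚ _ (heckeV N ξ) = (1 / 2 : ℚ) * ∑ M ∈ s,
      ξ M * ((Finset.univ.filter fun q : Gamma0Coset N => actP N q (Matrix.adjugate M) = q).card : ℚ) := by
  classical
  rw [LinearMap.trace_eq_matrix_trace ℚ (Pi.basisFun ℚ (Gamma0Coset N)), Matrix.trace]
  simp only [Matrix.diag, LinearMap.toMatrix_apply, Pi.basisFun_repr, Pi.basisFun_apply,
    heckeV_single_eq_sum hs, Pi.smul_apply, Finset.sum_apply, Pi.single_apply, smul_eq_mul, mul_ite,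
    mul_one, mul_zero]
  rw [← Finset.mul_sum, Finset.sum_comm]
  congr 1
  refine Finset.sum_congr rfl fun M _ => ?_
  rw [← Finset.sum_filter, Finset.sum_const, nsmul_eq_mul, mul_comm,
    show (Finset.univ.filter fun x : Gamma0Coset N => x = actP N x (Matrix.adjugate M)) =
      Finset.univ.filter fun q : Gamma0Coset N => actP N q (Matrix.adjugate M) = q from
      Finset.filter_congr fun q _ => eq_comm]

/-! ### `Ψ ∘ 𝔗_ξ = T_n^* ∘ Ψ` (property (A)) -/

/-- **Hecke compatibility of `Ψ`**: for `ξ` finitely supported on determinant `n`, `(n, N) = 1`, with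
property (A) in orbit form, `Ψ(𝔗_ξ v) = Ψ(v) ∘ T_n` for all `v ∈ V` (from `finsum_smul_msymbol_eq`
on basis vectors). [cite: PopaZagier2017, Thm. 1, §5] -/
theorem msymbolMap_heckeV {n : ℕ} (hn : 0 < n) (hnN : n.Coprime N)
    {ξ : Matrix (Fin 2) (Fin 2) ℤ → ℚ}
    (hfin : (Function.support ξ).Finite) (hdet : ∀ M, ξ M ≠ 0 → M.det = n)
    (hA : ∀ M : Matrix (Fin 2) (Fin 2) ℤ, M.det = n →
      orbT (zeta0 ξ) M = (if M 1 0 = 0 then 1 else 0) - (if M 1 1 = 0 then 1 else 0))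
    (v : Gamma0Coset N → ℚ) :
    msymbolMap N (heckeV N ξ v) = (msymbolMap N v) ∘ₗ heckeTnGamma0 N 2 n := by
  suffices h : msymbolMap N ∘ₗ heckeV N ξ =
      ((Module.Dual.transpose (R := ℂ) (heckeTnGamma0 N 2 n)).restrictScalars ℚ) ∘ₗ msymbolMap N by
    have := LinearMap.congr_fun h v
    rw [LinearMap.comp_apply, LinearMap.comp_apply, LinearMap.restrictScalars_apply,
      Module.Dual.transpose_apply] at this
    exact this
  refine (Pi.basisFun ℚ (Gamma0Coset N)).ext fun q => ?_
  rw [LinearMap.comp_apply, LinearMap.comp_apply, Pi.basisFun_apply, heckeV_single, map_smul,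
    msymbolMap_single, one_smul, LinearMap.restrictScalars_apply, Module.Dual.transpose_apply,
    map_finsum_linearMap (msymbolMap N) (finite_support_smul_of_finite hfin _)]
  simp only [map_smul, msymbolMap_single, one_smul]
  apply LinearMap.ext
  intro f
  rw [LinearMap.smul_apply, LinearMap.comp_apply,
    show (∑ᶠ M : Matrix (Fin 2) (Fin 2) ℤ, ξ M • msymbol N (actP N q (Matrix.adjugate M))) f =
      ∑ᶠ M : Matrix (Fin 2) (Fin 2) ℤ, ξ M • msymbol N (actP N q (Matrix.adjugate M)) f from
      (LinearMap.evalAddMonoidHom f).map_finsum (finite_support_smul_of_finite hfin _),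
    finsum_smul_msymbol_eq f hn hnN hfin hdet hA q, smul_smul,
    show (1 / 2 : ℚ) * 2 = 1 by norm_num, one_smul]

/-! ### `𝔗_ξ` and the relation module (property (B)) -/

section Relations

variable {n : ℤ} {ξ : Matrix (Fin 2) (Fin 2) ℤ → ℚ}

omit [NeZero N] in
/-- Goodness of `adj M` on the support: `det (adj M) = n` is a unit mod `N`. [folklore] -/
theorem isUnit_det_adjugate_of (hH : HeckeHyp n ξ) (hnN : IsUnit ((n : ℤ) : ZMod N))
    {M : Matrix (Fin 2) (Fin 2) ℤ} (hM : ξ M ≠ 0) :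
    IsUnit (((Matrix.adjugate M).det : ℤ) : ZMod N) := by
  rw [Matrix.det_adjugate, hH.det_eq M hM]; simpa using hnN

omit [NeZero N] in
/-- Goodness of `M` on the support. [folklore] -/
theorem isUnit_det_of (hH : HeckeHyp n ξ) (hnN : IsUnit ((n : ℤ) : ZMod N))
    {M : Matrix (Fin 2) (Fin 2) ℤ} (hM : ξ M ≠ 0) : IsUnit ((M.det : ℤ) : ZMod N) := by
  rw [hH.det_eq M hM]; exact hnN

omit [NeZero N] in
/-- Goodness of an `SL₂(ℤ)` matrix. [folklore] -/
theorem isUnit_det_of_det_eq_one {A : Matrix (Fin 2) (Fin 2) ℤ} (hA : A.det = 1) :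
    IsUnit ((A.det : ℤ) : ZMod N) := by
  rw [hA, Int.cast_one]; exact isUnit_one

/-- The summand reindexed: `ξ(M) e_{(q·g)·adj M} = ξ(M) e_{q·adj(M adj g)}` for `g ∈ SL₂(ℤ)`. [folklore] -/
theorem smul_single_actP_actP (hH : HeckeHyp n ξ) (hnN : IsUnit ((n : ℤ) : ZMod N))
    (q : Gamma0Coset N) {g : Matrix (Fin 2) (Fin 2) ℤ} (hg : g.det = 1) (M : Matrix (Fin 2) (Fin 2) ℤ) :
    ξ M • (Pi.single (actP N (actP N q g) (Matrix.adjugate M)) (1 : ℚ) : Gamma0Coset N → ℚ) =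
      ξ M • Pi.single (actP N q (Matrix.adjugate (M * Matrix.adjugate g))) 1 := by
  by_cases hM : ξ M = 0
  · simp only [hM, zero_smul]
  · rw [(cosetAction_actP N).act_mul q (isUnit_det_of_det_eq_one hg) (isUnit_det_adjugate_of hH hnN hM),
      Matrix.adjugate_mul_distrib, adjugate_adjugate_two]

/-- **Right translation of the sum**: `∑_M ξ(M) e_{(q·g)·adj M} = ∑_M ξ(M g) e_{q · adj M}` for
`g ∈ SL₂(ℤ)` (reindex `M ↦ M g`). [folklore] -/
theorem finsum_smul_single_actP_actP (hH : HeckeHyp n ξ) (hnN : IsUnit ((n : ℤ) : ZMod N))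
    (q : Gamma0Coset N) {g : Matrix (Fin 2) (Fin 2) ℤ} (hg : g.det = 1) :
    ∑ᶠ M : Matrix (Fin 2) (Fin 2) ℤ,
        ξ M • (Pi.single (actP N (actP N q g) (Matrix.adjugate M)) (1 : ℚ) : Gamma0Coset N → ℚ) =
      ∑ᶠ M : Matrix (Fin 2) (Fin 2) ℤ,
        ξ (M * g) • (Pi.single (actP N q (Matrix.adjugate M)) (1 : ℚ) : Gamma0Coset N → ℚ) := by
  have hg1 : g * Matrix.adjugate g = 1 := by rw [Matrix.mul_adjugate, hg, one_smul]
  have hg2 : Matrix.adjugate g * g = 1 := by rw [Matrix.adjugate_mul, hg, one_smul]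
  rw [finsum_congr (smul_single_actP_actP hH hnN q hg)]
  refine (finsum_comp_equiv (mulRightEquiv g (Matrix.adjugate g) hg1 hg2)
    (f := fun M => ξ M • (Pi.single (actP N q (Matrix.adjugate (M * Matrix.adjugate g))) (1 : ℚ) :
      Gamma0Coset N → ℚ))).symm.trans (finsum_congr fun M => ?_)
  simp only [mulRightEquiv_apply, Matrix.mul_assoc, hg1, Matrix.mul_one]

/-- `𝔗_ξ(e_{q·g}) = ½ ∑_M ξ(M g) e_{q·adj M}` for `g ∈ SL₂(ℤ)`. [folklore] -/
theorem heckeV_single_actP (hH : HeckeHyp n ξ) (hnN : IsUnit ((n : ℤ) : ZMod N))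
    (q : Gamma0Coset N) {g : Matrix (Fin 2) (Fin 2) ℤ} (hg : g.det = 1) :
    heckeV N ξ (Pi.single (actP N q g) 1) = (1 / 2 : ℚ) • ∑ᶠ M : Matrix (Fin 2) (Fin 2) ℤ,
      ξ (M * g) • (Pi.single (actP N q (Matrix.adjugate M)) (1 : ℚ) : Gamma0Coset N → ℚ) := by
  rw [heckeV_single, finsum_smul_single_actP_actP hH hnN q hg]

/-- Finiteness of a right translate of `ξ`. [folklore] -/
theorem finite_support_mul_right (hH : HeckeHyp n ξ) {g : Matrix (Fin 2) (Fin 2) ℤ} (hg : g.det = 1) :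
    (Function.support fun M => ξ (M * g)).Finite :=
  finite_support_comp hH.finite (mulRightEquiv g (Matrix.adjugate g)
    (by rw [Matrix.mul_adjugate, hg, one_smul]) (by rw [Matrix.adjugate_mul, hg, one_smul])).injective

/-- `det (U U) = 1`. [folklore] -/
theorem det_matU_mul_matU : (matU * matU).det = 1 := by rw [Matrix.det_mul, det_matU, mul_one]

/-- **`𝔗_ξ` on a two-term relation**: `𝔗_ξ(e_q + e_{S⁻¹q}) = ½ ∑_M (ξ(M) + ξ(MS)) e_{q·adj M}`.
[cite: PopaZagier2017, proof of Lemma 5] -/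
theorem heckeV_relTwo_single (hH : HeckeHyp n ξ) (hnN : IsUnit ((n : ℤ) : ZMod N)) (q : Gamma0Coset N) :
    heckeV N ξ (relTwo N (Pi.single q 1)) = (1 / 2 : ℚ) • ∑ᶠ M : Matrix (Fin 2) (Fin 2) ℤ,
      (ξ M + ξ (M * matS)) • (Pi.single (actP N q (Matrix.adjugate M)) (1 : ℚ) : Gamma0Coset N → ℚ) := by
  rw [relTwo_single, map_add, heckeV_single,
    show S⁻¹ • q = actP N q matS by rw [← coe_S_eq_matS, actP_coe], heckeV_single_actP hH hnN q det_matS,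
    ← smul_add, ← finsum_add_distrib (finite_support_smul_of_finite hH.finite _)
      (finite_support_smul_of_finite (finite_support_mul_right hH det_matS) _)]
  congr 1
  exact finsum_congr fun M => (add_smul _ _ _).symm

/-- **`𝔗_ξ` on a three-term relation**:
`𝔗_ξ(e_q + e_{(TS)⁻¹q} + e_{(TS)⁻²q}) = ½ ∑_M (ξ(M) + ξ(MU) + ξ(MU²)) e_{q·adj M}`.
[cite: PopaZagier2017, proof of Lemma 5] -/
theorem heckeV_relThree_single (hH : HeckeHyp n ξ) (hnN : IsUnit ((n : ℤ) : ZMod N)) (q : Gamma0Coset N) :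
    heckeV N ξ (relThree N (Pi.single q 1)) = (1 / 2 : ℚ) • ∑ᶠ M : Matrix (Fin 2) (Fin 2) ℤ,
      (ξ M + ξ (M * matU) + ξ (M * matU * matU)) •
        (Pi.single (actP N q (Matrix.adjugate M)) (1 : ℚ) : Gamma0Coset N → ℚ) := by
  have hC := cosetAction_actP N
  have h1 : (T * S)⁻¹ • q = actP N q matU := by rw [← coe_T_mul_S_eq_matU, actP_coe]
  have h2 : ((T * S)⁻¹) ^ 2 • q = actP N q (matU * matU) := by
    rw [pow_two, mul_smul, h1, ← actP_coe, coe_T_mul_S_eq_matU,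
      hC.act_mul q (isUnit_det_of_det_eq_one det_matU) (isUnit_det_of_det_eq_one det_matU)]
  have hf1 := finite_support_smul_of_finite hH.finite
    (fun M => (Pi.single (actP N q (Matrix.adjugate M)) (1 : ℚ) : Gamma0Coset N → ℚ))
  have hf2 := finite_support_smul_of_finite (finite_support_mul_right hH det_matU)
    (fun M => (Pi.single (actP N q (Matrix.adjugate M)) (1 : ℚ) : Gamma0Coset N → ℚ))
  have hf3 := finite_support_smul_of_finite (finite_support_mul_right hH det_matU_mul_matU)
    (fun M => (Pi.single (actP N q (Matrix.adjugate M)) (1 : ℚ) : Gamma0Coset N → ℚ))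
  rw [relThree_single, map_add, map_add, heckeV_single, h1, h2,
    heckeV_single_actP hH hnN q det_matU, heckeV_single_actP hH hnN q det_matU_mul_matU,
    ← smul_add, ← smul_add, ← finsum_add_distrib hf1 hf2,
    ← finsum_add_distrib ((hf1.union hf2).subset (Function.support_add _ _)) hf3]
  congr 1
  refine finsum_congr fun M => ?_
  rw [add_smul, add_smul, Matrix.mul_assoc]

/-- **A `(TS)^*`-fixed sum**: if `φ` is finitely supported on matrices of determinant prime to `N`
and left-`U`-invariant, then `∑_M φ(M) e_{q·adj M}` is fixed by `(TS)^*`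
(reindex `M ↦ U M`). [cite: PopaZagier2017, proof of Lemma 5] -/
theorem cosetPerm_TS_finsum_eq {φ : Matrix (Fin 2) (Fin 2) ℤ → ℚ} (hφfin : (Function.support φ).Finite)
    (hφdet : ∀ M, φ M ≠ 0 → IsUnit (((Matrix.adjugate M).det : ℤ) : ZMod N))
    (hφU : ∀ M, φ (matU * M) = φ M) (q : Gamma0Coset N) :
    cosetPerm (T * S) (∑ᶠ M : Matrix (Fin 2) (Fin 2) ℤ,
        φ M • (Pi.single (actP N q (Matrix.adjugate M)) (1 : ℚ) : Gamma0Coset N → ℚ)) =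
      ∑ᶠ M : Matrix (Fin 2) (Fin 2) ℤ,
        φ M • (Pi.single (actP N q (Matrix.adjugate M)) (1 : ℚ) : Gamma0Coset N → ℚ) := by
  have hC := cosetAction_actP N
  rw [map_finsum_linearMap (cosetPerm (N := N) (T * S)) (finite_support_smul_of_finite hφfin _)]
  simp only [map_smul, cosetPerm_single]
  have step : ∀ M, φ M • (Pi.single ((T * S)⁻¹ • actP N q (Matrix.adjugate M)) (1 : ℚ) : Gamma0Coset N → ℚ) =
      φ M • Pi.single (actP N q (Matrix.adjugate (Matrix.adjugate matU * M))) 1 := fun M => by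
    by_cases hM : φ M = 0
    · simp only [hM, zero_smul]
    · rw [← actP_coe, coe_T_mul_S_eq_matU,
        hC.act_mul q (hφdet M hM) (isUnit_det_of_det_eq_one det_matU), Matrix.adjugate_mul_distrib,
        adjugate_adjugate_two]
  rw [finsum_congr step]
  refine (finsum_comp_equiv (mulLeftEquiv matU (Matrix.adjugate matU) matU_mul_adjugate adjugate_mul_matU)
    (f := fun M => φ M • (Pi.single (actP N q (Matrix.adjugate (Matrix.adjugate matU * M))) (1 : ℚ) :
      Gamma0Coset N → ℚ))).symm.trans (finsum_congr fun M => ?_)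
  simp only [mulLeftEquiv_apply, ← Matrix.mul_assoc, adjugate_mul_matU, Matrix.one_mul, hφU]

/-- **An `S^*`-fixed sum**: if `φ` is finitely supported on matrices of determinant prime to `N` and
left-`S`-invariant, then `∑_M φ(M) e_{q·adj M}` is fixed by `S^*` (reindex `M ↦ S M`).
[cite: PopaZagier2017, proof of Lemma 5] -/
theorem cosetPerm_S_finsum_eq {φ : Matrix (Fin 2) (Fin 2) ℤ → ℚ} (hφfin : (Function.support φ).Finite)
    (hφdet : ∀ M, φ M ≠ 0 → IsUnit (((Matrix.adjugate M).det : ℤ) : ZMod N))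
    (hφS : ∀ M, φ (matS * M) = φ M) (q : Gamma0Coset N) :
    cosetPerm S (∑ᶠ M : Matrix (Fin 2) (Fin 2) ℤ,
        φ M • (Pi.single (actP N q (Matrix.adjugate M)) (1 : ℚ) : Gamma0Coset N → ℚ)) =
      ∑ᶠ M : Matrix (Fin 2) (Fin 2) ℤ,
        φ M • (Pi.single (actP N q (Matrix.adjugate M)) (1 : ℚ) : Gamma0Coset N → ℚ) := by
  have hC := cosetAction_actP N
  rw [map_finsum_linearMap (cosetPerm (N := N) S) (finite_support_smul_of_finite hφfin _)]
  simp only [map_smul, cosetPerm_single]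
  have step : ∀ M, φ M • (Pi.single (S⁻¹ • actP N q (Matrix.adjugate M)) (1 : ℚ) : Gamma0Coset N → ℚ) =
      φ M • Pi.single (actP N q (Matrix.adjugate (-matS * M))) 1 := fun M => by
    by_cases hM : φ M = 0
    · simp only [hM, zero_smul]
    · rw [← actP_coe, coe_S_eq_matS, hC.act_mul q (hφdet M hM) (isUnit_det_of_det_eq_one det_matS),
        Matrix.adjugate_mul_distrib, adjugate_neg_two, adjugate_matS, neg_neg]
  rw [finsum_congr step]
  refine (finsum_comp_equiv (mulLeftEquiv matS (-matS) matS_mul_neg_matS neg_matS_mul_matS)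
    (f := fun M => φ M • (Pi.single (actP N q (Matrix.adjugate (-matS * M))) (1 : ℚ) :
      Gamma0Coset N → ℚ))).symm.trans (finsum_congr fun M => ?_)
  simp only [mulLeftEquiv_apply, ← Matrix.mul_assoc, neg_matS_mul_matS, Matrix.one_mul, hφS]

omit [NeZero N] in
/-- A `(TS)^*`-fixed vector lies in `range(1 + (TS)^* + (TS)^{*2})`. [folklore] -/
theorem mem_range_relThree_of_fixed {v : Gamma0Coset N → ℚ} (hv : cosetPerm (T * S) v = v) :
    v ∈ LinearMap.range (relThree N) := by
  refine ⟨(1 / 3 : ℚ) • v, ?_⟩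
  rw [map_smul, relThree, LinearMap.add_apply, LinearMap.add_apply, LinearMap.id_apply,
    LinearMap.comp_apply, hv, hv]
  ext x; simp only [Pi.smul_apply, Pi.add_apply, smul_eq_mul]; ring

omit [NeZero N] in
/-- An `S^*`-fixed vector lies in `range(1 + S^*)`. [folklore] -/
theorem mem_range_relTwo_of_fixed {v : Gamma0Coset N → ℚ} (hv : cosetPerm S v = v) :
    v ∈ LinearMap.range (relTwo N) := by
  refine ⟨(1 / 2 : ℚ) • v, ?_⟩
  rw [map_smul, relTwo, LinearMap.add_apply, LinearMap.id_apply, hv]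
  ext x; simp only [Pi.smul_apply, Pi.add_apply, smul_eq_mul]; ring

/-- **`𝔗_ξ(range(1 + S^*)) ⊆ range(1 + (TS)^* + (TS)^{*2})`** for `ξ` with property (B)
(Popa–Zagier: `T̃(1 + S) ∈ (1 + U + U²)ℤ[M_n]`). [cite: PopaZagier2017, proof of Lemma 5] -/
theorem heckeV_mem_range_relThree (hH : HeckeHyp n ξ) (hnN : IsUnit ((n : ℤ) : ZMod N)) :
    ∀ a ∈ LinearMap.range (relTwo N), heckeV N ξ a ∈ LinearMap.range (relThree N) := by
  classical
  rintro _ ⟨c, rfl⟩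
  rw [← Finset.univ_sum_single c, map_sum, map_sum]
  refine Submodule.sum_mem _ fun q _ => ?_
  rw [← mul_one (c q), ← smul_eq_mul, Pi.single_smul, map_smul, map_smul]
  refine Submodule.smul_mem _ _ ?_
  rw [heckeV_relTwo_single hH hnN q]
  refine Submodule.smul_mem _ _ (mem_range_relThree_of_fixed (cosetPerm_TS_finsum_eq ?_ ?_ ?_ q))
  · exact (hH.finite.union (finite_support_mul_right hH det_matS)).subset (Function.support_add _ _)
  · intro M hM
    have h : ξ M ≠ 0 ∨ ξ (M * matS) ≠ 0 := by
      by_contra h'; push Not at h'; exact hM (by rw [h'.1, h'.2, add_zero])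
    rcases h with h | h
    · exact isUnit_det_adjugate_of hH hnN h
    · have := hH.det_eq _ h
      rw [Matrix.det_mul, det_matS, mul_one] at this
      rw [Matrix.det_adjugate, this]; simpa using hnN
  · intro M
    rw [Matrix.mul_assoc] ; exact (hH.propB1 M).symm ▸ by rw [← Matrix.mul_assoc]

/-- **`𝔗_ξ(range(1 + (TS)^* + (TS)^{*2})) ⊆ range(1 + S^*)`** for `ξ` with property (B)
(Popa–Zagier: `T̃(1 + U + U²) ∈ (1 + S)ℤ[M_n]`). [cite: PopaZagier2017, proof of Lemma 5] -/
theorem heckeV_mem_range_relTwo (hH : HeckeHyp n ξ) (hnN : IsUnit ((n : ℤ) : ZMod N)) :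
    ∀ b ∈ LinearMap.range (relThree N), heckeV N ξ b ∈ LinearMap.range (relTwo N) := by
  classical
  rintro _ ⟨c, rfl⟩
  rw [← Finset.univ_sum_single c, map_sum, map_sum]
  refine Submodule.sum_mem _ fun q _ => ?_
  rw [← mul_one (c q), ← smul_eq_mul, Pi.single_smul, map_smul, map_smul]
  refine Submodule.smul_mem _ _ ?_
  rw [heckeV_relThree_single hH hnN q]
  refine Submodule.smul_mem _ _ (mem_range_relTwo_of_fixed (cosetPerm_S_finsum_eq ?_ ?_ ?_ q))
  · refine ((hH.finite.union (finite_support_mul_right hH det_matU)).union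
      (finite_support_mul_right hH det_matU_mul_matU)).subset fun M hM => ?_
    simp only [Function.mem_support, Set.mem_union, Matrix.mul_assoc] at hM ⊢
    by_contra h'
    push Not at h'
    exact hM (by rw [h'.1.1, h'.1.2, h'.2, add_zero, add_zero])
  · intro M hM
    have h : ξ M ≠ 0 ∨ ξ (M * matU) ≠ 0 ∨ ξ (M * matU * matU) ≠ 0 := by
      by_contra h'; push Not at h'; exact hM (by rw [h'.1, h'.2.1, h'.2.2, add_zero, add_zero])
    have key : M.det = n := by
      rcases h with h | h | h
      · exact hH.det_eq _ h
      · have := hH.det_eq _ h; rwa [Matrix.det_mul, det_matU, mul_one] at this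
      · have := hH.det_eq _ h; rwa [Matrix.det_mul, Matrix.det_mul, det_matU, mul_one, mul_one] at this
    rw [Matrix.det_adjugate, key]; simpa using hnN
  · intro M
    have := hH.propB2 M
    simp only [Matrix.mul_assoc] at this ⊢
    exact this.symm

end Relations

/-! ### `𝔗_ξ` on the constants and the trace on the relation module -/

section RelTrace

variable {n : ℤ} {ξ : Matrix (Fin 2) (Fin 2) ℤ → ℚ}

omit [NeZero N] in
/-- A scalar matrix `d · 1` with `d` a unit mod `N` acts trivially on `ℙ¹(ℤ/N)`. [folklore] -/
theorem smulP1_smul_one {d : ℤ} (hd : IsUnit ((d : ℤ) : ZMod N)) (x : P1 N) :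
    smulP1 N (d • (1 : Matrix (Fin 2) (Fin 2) ℤ)) x = x := by
  have h1 : IsUnit (redMat N (d • (1 : Matrix (Fin 2) (Fin 2) ℤ))).det := by
    rw [isUnit_det_redMat_iff, Matrix.det_smul, Matrix.det_one, mul_one, Fintype.card_fin, Int.cast_pow]
    exact hd.pow 2
  induction x using P1.ind with
  | h v =>
    rw [smulP1_mk N h1, P1.mk_eq_mk_iff]
    simp only [UniCol.mulVec, Matrix.mulVec, dotProduct, Fin.sum_univ_two, redMat_apply,
      Matrix.smul_apply, Matrix.one_apply, smul_eq_mul]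
    simp
    ring

/-- `q · (d · 1) = q` for `d` a unit mod `N`. [folklore] -/
theorem actP_smul_one (q : Gamma0Coset N) {d : ℤ} (hd : IsUnit ((d : ℤ) : ZMod N)) :
    actP N q (d • (1 : Matrix (Fin 2) (Fin 2) ℤ)) = q := by
  apply (cosetEquivP1 N).injective
  rw [cosetEquivP1_actP, Matrix.adjugate_smul, Matrix.adjugate_one, Fintype.card_fin,
    show d ^ (2 - 1) = d by norm_num, smulP1_smul_one hd]

/-- `(q · adj M) · M = q` when `det M` is a unit mod `N`. [folklore] -/
theorem actP_adjugate_actP {M : Matrix (Fin 2) (Fin 2) ℤ} (hM : IsUnit ((M.det : ℤ) : ZMod N))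
    (q : Gamma0Coset N) : actP N (actP N q (Matrix.adjugate M)) M = q := by
  have hMa : IsUnit (((Matrix.adjugate M).det : ℤ) : ZMod N) := by
    rw [Matrix.det_adjugate]; simpa using hM
  rw [(cosetAction_actP N).act_mul q hMa hM, Matrix.adjugate_mul, actP_smul_one q hM]

/-- `q ↦ q · adj M` is a bijection of `X` when `det M` is a unit mod `N`. [folklore] -/
theorem bijective_actP_adjugate {M : Matrix (Fin 2) (Fin 2) ℤ} (hM : IsUnit ((M.det : ℤ) : ZMod N)) :
    Function.Bijective fun q : Gamma0Coset N => actP N q (Matrix.adjugate M) :=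
  (Finite.injective_iff_bijective.mp fun q q' h => by
    have := congrArg (fun x => actP N x M) h
    simpa only [actP_adjugate_actP hM] using this)

/-- `∑_q e_{σ q} = 𝟙` for a bijection `σ` of `X`. [folklore] -/
theorem sum_single_of_bijective {σ : Gamma0Coset N → Gamma0Coset N} (hσ : Function.Bijective σ) :
    ∑ q, (Pi.single (σ q) (1 : ℚ) : Gamma0Coset N → ℚ) = fun _ => 1 := by
  have h := (Equiv.ofBijective σ hσ).sum_comp (fun x => (Pi.single x (1 : ℚ) : Gamma0Coset N → ℚ))
  simp only [Equiv.ofBijective_apply] at h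
  rw [h]
  exact Finset.univ_sum_single (fun _ : Gamma0Coset N => (1 : ℚ))

/-- **`𝔗_ξ(𝟙) = (½ ∑_M ξ(M)) 𝟙`**: each `q ↦ q · adj M` on the support permutes `X`.
[cite: Popa2014, §2 "The proof"] -/
theorem heckeV_const (hH : HeckeHyp n ξ) (hnN : IsUnit ((n : ℤ) : ZMod N)) :
    heckeV N ξ (fun _ => 1) = ((1 / 2 : ℚ) * ∑ᶠ M, ξ M) • (fun _ => (1 : ℚ)) := by
  classical
  set s := hH.finite.toFinset with hs
  have hsub : Function.support ξ ⊆ s := by rw [hs, Set.Finite.coe_toFinset]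
  rw [finsum_eq_sum_of_support_subset _ hsub]
  conv_lhs => rw [← Finset.univ_sum_single (fun _ : Gamma0Coset N => (1 : ℚ))]
  rw [map_sum]
  simp only [heckeV_single_eq_sum hsub]
  rw [← Finset.smul_sum, Finset.sum_comm, mul_smul, Finset.sum_smul]
  congr 1
  refine Finset.sum_congr rfl fun M hM => ?_
  rw [← Finset.smul_sum]
  by_cases h0 : ξ M = 0
  · simp only [h0, zero_smul]
  · rw [sum_single_of_bijective (bijective_actP_adjugate (isUnit_det_of hH hnN h0))]

omit [NeZero N] in
/-- `𝟙 ∈ range(1 + S^*)`. [folklore] -/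
theorem const_mem_range_relTwo : (fun _ => (1 : ℚ)) ∈ LinearMap.range (relTwo N) :=
  mem_range_relTwo_of_fixed rfl

omit [NeZero N] in
/-- `𝟙 ∈ range(1 + (TS)^* + (TS)^{*2})`. [folklore] -/
theorem const_mem_range_relThree : (fun _ => (1 : ℚ)) ∈ LinearMap.range (relThree N) :=
  mem_range_relThree_of_fixed rfl

omit [NeZero N] in
/-- **`range(1 + S^*) ∩ range(1 + (TS)^* + (TS)^{*2}) = ℚ · 𝟙`** (a vector in both is fixed by
`S^*` and `(TS)^*`, hence by `SL₂(ℤ)`, hence constant: `fixedS_inf_fixedTS_le`).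
[cite: PopaZagier2017, proof of Lemma 5] -/
theorem range_relTwo_inf_range_relThree :
    LinearMap.range (relTwo N) ⊓ LinearMap.range (relThree N) = Submodule.span ℚ {fun _ => (1 : ℚ)} :=
  le_antisymm ((inf_le_inf range_relTwo_le_fixedS range_relThree_le_fixedTS).trans fixedS_inf_fixedTS_le)
    ((Submodule.span_singleton_le_iff_mem _ _).mpr ⟨const_mem_range_relTwo, const_mem_range_relThree⟩)

/-- **`tr(𝔗_ξ | Rel) = ½ ∑_M ξ(M)`** for `ξ` with property (B): by the swap lemma the trace on
`Rel = range(1 + S^*) + range(1 + (TS)^* + (TS)^{*2})` equals the trace on the intersection `ℚ · 𝟙`,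
where `𝔗_ξ` acts by `½ ∑_M ξ(M)` (Popa–Zagier 2017, Lemma 5: `tr(T̃ | I) = -2σ₁(n) + [n = □]`
for the original element with `∑ c(M) = -σ₁(n)` per sign). [cite: PopaZagier2017, proof of Lemma 5] -/
theorem trace_heckeV_relModule (hH : HeckeHyp n ξ) (hnN : IsUnit ((n : ℤ) : ZMod N))
    (hRel : ∀ x ∈ LinearMap.range (relTwo N) ⊔ LinearMap.range (relThree N),
      heckeV N ξ x ∈ LinearMap.range (relTwo N) ⊔ LinearMap.range (relThree N)) :
    LinearMap.trace ℚ _ ((heckeV N ξ).restrict hRel) = (1 / 2 : ℚ) * ∑ᶠ M, ξ M := by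
  have hinf : ∀ x ∈ LinearMap.range (relTwo N) ⊓ LinearMap.range (relThree N),
      heckeV N ξ x ∈ LinearMap.range (relTwo N) ⊓ LinearMap.range (relThree N) := fun x hx =>
    ⟨heckeV_mem_range_relTwo hH hnN x hx.2, heckeV_mem_range_relThree hH hnN x hx.1⟩
  rw [HeckeTraceLinearAlgebra.trace_restrict_sup_eq_trace_restrict_inf (heckeV N ξ) _ _
    (heckeV_mem_range_relThree hH hnN) (heckeV_mem_range_relTwo hH hnN) hRel hinf]
  -- on the line `ℚ · 𝟙` the operator is the scalar `½ ∑ ξ(M)`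
  set c : ℚ := (1 / 2 : ℚ) * ∑ᶠ M, ξ M with hc
  have hone : (fun _ => (1 : ℚ)) ∈ LinearMap.range (relTwo N) ⊓ LinearMap.range (relThree N) :=
    ⟨const_mem_range_relTwo, const_mem_range_relThree⟩
  have hne : (⟨fun _ => (1 : ℚ), hone⟩ : ↥(LinearMap.range (relTwo N) ⊓ LinearMap.range (relThree N))) ≠ 0 := by
    intro h
    have := congrArg (fun v : ↥(LinearMap.range (relTwo N) ⊓ LinearMap.range (relThree N)) =>
      (v : Gamma0Coset N → ℚ) ((1 : SL(2, ℤ)) : Gamma0Coset N)) h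
    simp at this
  have hdim : Module.finrank ℚ ↥(LinearMap.range (relTwo N) ⊓ LinearMap.range (relThree N)) = 1 := by
    rw [range_relTwo_inf_range_relThree, finrank_span_singleton]
    intro h
    have := congrFun h ((1 : SL(2, ℤ)) : Gamma0Coset N)
    simp at this
  have hscalar : (heckeV N ξ).restrict hinf = c • LinearMap.id := by
    apply LinearMap.ext
    intro v
    obtain ⟨a, ha⟩ := (finrank_eq_one_iff_of_nonzero' _ hne).mp hdim v
    apply Subtype.ext
    rw [LinearMap.restrict_apply, LinearMap.smul_apply, LinearMap.id_apply, Submodule.coe_smul, Subtype.coe_mk]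
    have hv : (v : Gamma0Coset N → ℚ) = a • fun _ => (1 : ℚ) := by rw [← ha]; rfl
    rw [hv, map_smul, heckeV_const hH hnN, ← hc, smul_comm]
  rw [hscalar, map_smul, LinearMap.trace_id, hdim, Nat.cast_one, smul_eq_mul, mul_one]

end RelTrace

/-! ### `δ ∘ 𝔗_ξ = σ₁(n) δ` (squarefree level) -/

/-- **Boundary compatibility of `𝔗_ξ`** at squarefree level: `δ(𝔗_ξ v) = σ₁(n) δ(v)`.
[cite: Popa2014, §2] -/
theorem bdryMap_heckeV (hN : Squarefree N) {n : ℕ} (hn : 0 < n) (hnN : n.Coprime N)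
    {ξ : Matrix (Fin 2) (Fin 2) ℤ → ℚ}
    (hfin : (Function.support ξ).Finite) (hdet : ∀ M, ξ M ≠ 0 → M.det = n)
    (hA : ∀ M : Matrix (Fin 2) (Fin 2) ℤ, M.det = n →
      orbT (zeta0 ξ) M = (if M 1 0 = 0 then 1 else 0) - (if M 1 1 = 0 then 1 else 0))
    (v : Gamma0Coset N → ℚ) :
    bdryMap N (heckeV N ξ v) = ((n.divisors.sum id : ℕ) : ℚ) • bdryMap N v := by
  suffices h : bdryMap N ∘ₗ heckeV N ξ = ((n.divisors.sum id : ℕ) : ℚ) • bdryMap N from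
    LinearMap.congr_fun h v
  refine (Pi.basisFun ℚ (Gamma0Coset N)).ext fun q => ?_
  rw [LinearMap.comp_apply, LinearMap.smul_apply, Pi.basisFun_apply, heckeV_single, map_smul,
    bdryMap_single, one_smul, map_finsum_linearMap (bdryMap N) (finite_support_smul_of_finite hfin _)]
  simp only [map_smul, bdryMap_single, one_smul]
  rw [finsum_smul_bdryVec_eq hN hn hnN hfin hdet hA q, smul_smul, Nat.cast_mul, Nat.cast_ofNat,
    show (1 / 2 : ℚ) * (2 * ((n.divisors.sum id : ℕ) : ℚ)) = ((n.divisors.sum id : ℕ) : ℚ) by ring]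

/-! ### Exactness of `0 → Rel → ker δ → S₂(Γ₀(N))^∧` by dimension count, and the trace identity -/

section Assembly

/-- Traces of restrictions to equal submodules agree. [folklore] -/
theorem trace_restrict_congr {k : Type*} [Field k] {W : Type*} [AddCommGroup W] [Module k W]
    (f : W →ₗ[k] W) {p p' : Submodule k W} (h : p = p') (hp : ∀ x ∈ p, f x ∈ p) (hp' : ∀ x ∈ p', f x ∈ p') :
    LinearMap.trace k p (f.restrict hp) = LinearMap.trace k p' (f.restrict hp') := by
  subst h; rfl

variable (N) in
/-- The numerical data of `X₀(N)`: `μ = #X`, `ε₂`, `ε₃`, `ε_∞`, `g = dim S₂(Γ₀(N))` satisfy the genus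
formula `12 g + 3ε₂ + 4ε₃ + 6ε_∞ = 12 + μ` (Diamond–Shurman Thm. 3.1.1 with Thm. 3.5.1, the tree's
`twelve_mul_finrank_cuspForm_two_gamma0_holds`). [cite: DiamondShurman2005, Thm. 3.1.1] -/
theorem genus_formula_card :
    12 * Module.finrank ℂ (CuspForm (Gamma0 N) 2) +
        3 * (Finset.univ.filter fun q : Gamma0Coset N => S • q = q).card +
        4 * (Finset.univ.filter fun q : Gamma0Coset N => (T * S) • q = q).card +
        6 * Nat.card (CuspOrbits (Gamma0 N : Subgroup (GL (Fin 2) ℝ))) =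
      12 + Fintype.card (Gamma0Coset N) := by
  have h := twelve_mul_finrank_cuspForm_two_gamma0_holds N (Gamma0_is_congruence N)
  rw [adjoinNegI_gamma0, ellipticPointCount_two_gamma0_eq_card, ellipticPointCount_three_gamma0_eq_card,
    Nat.card_eq_fintype_card (α := {q : SL(2, ℤ) ⧸ Gamma0 N // S • q = q}), Fintype.card_subtype,
    Nat.card_eq_fintype_card (α := {q : SL(2, ℤ) ⧸ Gamma0 N // (T * S) • q = q}), Fintype.card_subtype,
    Subgroup.index, Nat.card_eq_fintype_card (α := SL(2, ℤ) ⧸ Gamma0 N)] at h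
  exact h

/-- **Exactness by dimension count** (Manin 1972, Thm. 1.9; Cremona 1997, Thm. 2.1.2, with the
genus formula): with `U = ker δ`, `Ψ_U = Ψ|_U`, one has `ker Ψ_U = Rel`, `dim Ψ(U) = 2 dim S₂(Γ₀(N))`
and `rank δ + 1 = ε_∞`.  All the inequalities in the tree's `six_mul_finrank_span_periodHomology_le`
are equalities once `dim S₂ = g` is known. [cite: CremonaAlgorithms1997, §2.1 Thm. 2.1.2] -/
theorem manin_exactness :
    LinearMap.ker ((msymbolMap N).domRestrict (LinearMap.ker (bdryMap N))) =
        (relModule N).comap (LinearMap.ker (bdryMap N)).subtype ∧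
      Module.finrank ℚ (LinearMap.range ((msymbolMap N).domRestrict (LinearMap.ker (bdryMap N)))) =
        2 * Module.finrank ℂ (CuspForm (Gamma0 N) 2) ∧
      Module.finrank ℚ (LinearMap.range (bdryMap N)) + 1 = Nat.card (CuspOrbits (Gamma0 N : Subgroup (GL (Fin 2) ℝ))) ∧
      Submodule.span ℚ (periodHomology N : Set (Module.Dual ℂ (CuspForm (Gamma0 N) 2))) ≤
        LinearMap.range ((msymbolMap N).domRestrict (LinearMap.ker (bdryMap N))) := by
  set V := Gamma0Coset N → ℚ
  set U : Submodule ℚ V := LinearMap.ker (bdryMap N) with hU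
  set Ψ := msymbolMap N
  set g : U →ₗ[ℚ] Module.Dual ℂ (CuspForm (Gamma0 N) 2) := Ψ.domRestrict U
  have hUδ : Module.finrank ℚ (LinearMap.range (bdryMap N)) + Module.finrank ℚ U = Fintype.card (Gamma0Coset N) := by
    rw [LinearMap.finrank_range_add_finrank_ker, Module.finrank_fintype_fun_eq_card]
  have hε := card_cuspOrbits_le_finrank_range_bdryMap_add_one (N := N)
  have hg : Module.finrank ℚ (LinearMap.range g) + Module.finrank ℚ (LinearMap.ker g) = Module.finrank ℚ U :=
    LinearMap.finrank_range_add_finrank_ker g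
  have hrange : LinearMap.range g = U.map Ψ := LinearMap.range_domRestrict _ _
  have hker : (relModule N).comap U.subtype ≤ LinearMap.ker g := by
    intro x hx
    rw [LinearMap.mem_ker, LinearMap.domRestrict_apply]
    exact relModule_le_ker_msymbolMap hx
  have hRelcomap : Module.finrank ℚ (relModule N) = Module.finrank ℚ ((relModule N).comap U.subtype) :=
    (LinearEquiv.finrank_eq (Submodule.comapSubtypeEquivOfLe relModule_le_ker_bdryMap)).symm
  have hRel : Module.finrank ℚ ((relModule N).comap U.subtype) ≤ Module.finrank ℚ (LinearMap.ker g) :=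
    Submodule.finrank_mono hker
  have hRel' := finrank_relModule_ge (N := N)
  have hHle : Submodule.span ℚ (periodHomology N : Set (Module.Dual ℂ (CuspForm (Gamma0 N) 2))) ≤
      LinearMap.range g := by
    rw [hrange]
    exact Submodule.span_le.mpr periodHomology_le_map_ker
  have hH : Module.finrank ℚ (Submodule.span ℚ (periodHomology N : Set (Module.Dual ℂ (CuspForm (Gamma0 N) 2))))
      ≤ Module.finrank ℚ (LinearMap.range g) := Submodule.finrank_mono hHle
  have h2 := two_mul_finrank_cuspForm_two_le_finrank_span_periodHomology N
  have hgenus := genus_formula_card N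
  refine ⟨?_, by omega, by omega, hHle⟩
  exact (Submodule.eq_of_le_of_finrank_eq hker (by omega)).symm

variable {n : ℕ} {ξ : Matrix (Fin 2) (Fin 2) ℤ → ℚ}

/-- **The Popa–Zagier trace identity on M-symbols** (Popa 2018, §2 "The proof", in the dual
M-symbol formulation): for `N` squarefree, `(n, N) = 1` and `ξ` finitely supported on determinant
`n` with properties (A) (orbit form) and (B),
`2 tr(T_n | S₂(Γ₀(N))) = ½ ∑_M ξ(M) #{q : q·adj M = q} − ½ ∑_M ξ(M) − σ₁(n) (ε_∞ − 1)`.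
Ingredients: `tr(𝔗_ξ|V) = tr(𝔗_ξ|ker δ) + σ₁(n) rank δ` (`δ ∘ 𝔗_ξ = σ₁ δ`),
`tr(𝔗_ξ|ker δ) = tr(𝔗_ξ|Rel) + tr_ℚ(T_n^*|Ψ(ker δ))` (`Ψ ∘ 𝔗_ξ = T_n^* ∘ Ψ`, exactness),
`tr(𝔗_ξ|Rel) = ½ ∑ ξ(M)` (swap lemma), `tr_ℚ(T_n^*|Ψ(ker δ)) = tr_ℝ(T_n^*) = 2 Re tr_ℂ(T_n) = 2 tr(T_n)`
(`Ψ(ker δ)` is a full-rank `ℚ`-form of `S₂^∧`; `tr T_n` is real). [cite: Popa2014, §2 "The proof"] -/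
theorem two_mul_cuspidalHeckeTrace_eq (hN : Squarefree N) (hn : 0 < n) (hnN : n.Coprime N)
    (hH : HeckeHyp (n : ℤ) ξ)
    (hA : ∀ M : Matrix (Fin 2) (Fin 2) ℤ, M.det = n →
      orbT (zeta0 ξ) M = (if M 1 0 = 0 then 1 else 0) - (if M 1 1 = 0 then 1 else 0))
    {s : Finset (Matrix (Fin 2) (Fin 2) ℤ)} (hs : Function.support ξ ⊆ s) :
    2 * Literature.NumberTheory.Automorphic.HeckeTraceFormulaGL2Level.cuspidalHeckeTrace N 2 1 n =
      ((((1 / 2 : ℚ) * ∑ M ∈ s, ξ M *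
            ((Finset.univ.filter fun q : Gamma0Coset N => actP N q (Matrix.adjugate M) = q).card : ℚ)) -
          ((1 / 2 : ℚ) * ∑ M ∈ s, ξ M) -
          ((n.divisors.sum id : ℕ) : ℚ) * ((Nat.card (CuspOrbits (Gamma0 N : Subgroup (GL (Fin 2) ℝ))) : ℚ) - 1) : ℚ) : ℂ) := by
  classical
  haveI : FiniteDimensional ℂ (CuspForm (Gamma0 N) 2) := finiteDimensional_cuspForm_gamma0 N 2
  have hunit : IsUnit (((n : ℤ) : ℤ) : ZMod N) := by
    rw [Int.cast_natCast]; exact (ZMod.isUnit_iff_coprime n N).mpr hnN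
  have hdet : ∀ M, ξ M ≠ 0 → M.det = n := hH.det_eq
  -- notation
  set V := Gamma0Coset N → ℚ
  set 𝔗 : V →ₗ[ℚ] V := heckeV N ξ with h𝔗
  set δ := bdryMap N with hδ
  set Ψ := msymbolMap N with hΨ
  set U : Submodule ℚ V := LinearMap.ker δ with hU
  set σ : ℚ := ((n.divisors.sum id : ℕ) : ℚ) with hσ
  set Tn := heckeTnGamma0 N 2 n with hTn
  set W := Module.Dual ℂ (CuspForm (Gamma0 N) 2)
  set F : W →ₗ[ℝ] W := (Module.Dual.transpose (R := ℂ) Tn).restrictScalars ℝ with hF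
  obtain ⟨hexact, hdimY, hrank, hHle⟩ := manin_exactness (N := N)
  -- Step 1: `tr(𝔗|V) = tr(𝔗|U) + σ rank δ`
  have hδ𝔗 : ∀ v, δ (𝔗 v) = σ • δ v := bdryMap_heckeV hN hn hnN hH.finite hdet hA
  have hUst : ∀ x ∈ U, 𝔗 x ∈ U := fun x hx => by
    rw [hU, LinearMap.mem_ker] at hx ⊢
    rw [hδ𝔗, hx, smul_zero]
  have hstep1 : LinearMap.trace ℚ V 𝔗 =
      LinearMap.trace ℚ U (𝔗.restrict hUst) + σ * Module.finrank ℚ (LinearMap.range δ) := by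
    have hcomm : δ.rangeRestrict ∘ₗ 𝔗 = (σ • LinearMap.id) ∘ₗ δ.rangeRestrict := by
      apply LinearMap.ext; intro v; apply Subtype.ext
      simp [hδ𝔗]
    rw [HeckeTraceLinearAlgebra.trace_eq_trace_restrict_ker_add 𝔗 δ.rangeRestrict
      (LinearMap.surjective_rangeRestrict δ) _ hcomm, map_smul, LinearMap.trace_id, smul_eq_mul,
      trace_restrict_congr 𝔗 (LinearMap.ker_rangeRestrict δ)]
  -- Step 2: `tr(𝔗|U) = tr(𝔗|Rel) + tr_ℚ(T^*|Y)`
  set g : U →ₗ[ℚ] W := Ψ.domRestrict U with hg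
  set Y : Submodule ℚ W := LinearMap.range g with hY
  have hΨ𝔗 : ∀ v, Ψ (𝔗 v) = (Ψ v) ∘ₗ Tn := msymbolMap_heckeV hn hnN hH.finite hdet hA
  have hYst : ∀ y ∈ Y, F y ∈ Y := by
    rintro _ ⟨u, rfl⟩
    refine ⟨⟨𝔗 u, hUst u u.2⟩, ?_⟩
    rw [hg, LinearMap.domRestrict_apply, LinearMap.domRestrict_apply]
    exact hΨ𝔗 u
  have hRelst : ∀ x ∈ LinearMap.range (relTwo N) ⊔ LinearMap.range (relThree N),
      𝔗 x ∈ LinearMap.range (relTwo N) ⊔ LinearMap.range (relThree N) := fun x hx => by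
    obtain ⟨a, ha, b, hb, rfl⟩ := Submodule.mem_sup.mp hx
    rw [map_add]
    exact Submodule.add_mem _ (Submodule.mem_sup_right (heckeV_mem_range_relThree hH hunit a ha))
      (Submodule.mem_sup_left (heckeV_mem_range_relTwo hH hunit b hb))
  have hstep2 : LinearMap.trace ℚ U (𝔗.restrict hUst) =
      LinearMap.trace ℚ _ (𝔗.restrict hRelst) + LinearMap.trace ℚ Y ((F.restrictScalars ℚ).restrict hYst) := by
    have hRelU : relModule N ≤ U := relModule_le_ker_bdryMap
    refine HeckeTraceLinearAlgebra.trace_eq_add_of_exact (𝔗.restrict hUst)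
      (Submodule.inclusion hRelU) g.rangeRestrict (Submodule.inclusion_injective hRelU)
      (LinearMap.surjective_rangeRestrict g) ?_ (𝔗.restrict hRelst) ((F.restrictScalars ℚ).restrict hYst) ?_ ?_
    · rw [LinearMap.ker_rangeRestrict, hexact]
      apply le_antisymm
      · rintro _ ⟨x, rfl⟩
        exact x.2
      · intro x hx
        exact ⟨⟨x, hx⟩, rfl⟩
    · apply LinearMap.ext; intro x; rfl
    · apply LinearMap.ext; intro x; apply Subtype.ext
      change Ψ (𝔗 x) = (Ψ x) ∘ₗ Tn
      exact hΨ𝔗 x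
  -- Step 3: `tr(𝔗|Rel) = ½ ∑ ξ`
  have hstep3 : LinearMap.trace ℚ _ (𝔗.restrict hRelst) = (1 / 2 : ℚ) * ∑ M ∈ s, ξ M := by
    have h3 := trace_heckeV_relModule (N := N) hH hunit hRelst
    rw [finsum_eq_sum_of_support_subset _ hs] at h3
    exact h3
  -- Step 4: `tr_ℚ(F|Y) = tr_ℝ F = 2 Re tr_ℂ T_n`
  have hstep4 : ((LinearMap.trace ℚ Y ((F.restrictScalars ℚ).restrict hYst) : ℚ) : ℝ) =
      2 * (LinearMap.trace ℂ _ Tn).re := by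
    have hrankY : Module.finrank ℚ Y = Module.finrank ℝ W := by
      rw [hY, hdimY, finrank_real_of_complex, Subspace.dual_finrank_eq]
    have hspanY : Submodule.span ℝ (Y : Set W) = ⊤ := by
      apply top_unique
      rw [← periodHomology_span_eq_top (N := N),
        ← Submodule.span_span_of_tower ℚ ℝ (periodHomology N : Set W)]
      exact Submodule.span_mono hHle
    rw [HeckeTraceLinearAlgebra.trace_restrict_ratForm_eq Y hrankY hspanY F hYst, hF,
      HeckeTraceLinearAlgebra.trace_restrictScalars_real_eq, LinearMap.trace_transpose']
  -- Step 5: `tr(𝔗|V)` by fixed points; assemble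
  have hstep5 := trace_heckeV (N := N) hs (ξ := ξ)
  have hreal := ofReal_re_trace_heckeTnGamma0 N 2 hn hnN
  rw [← trace_heckeTnGamma0, ← hreal]
  have hq : (LinearMap.trace ℚ Y ((F.restrictScalars ℚ).restrict hYst) : ℚ) =
      ((1 / 2 : ℚ) * ∑ M ∈ s, ξ M *
          ((Finset.univ.filter fun q : Gamma0Coset N => actP N q (Matrix.adjugate M) = q).card : ℚ)) -
        ((1 / 2 : ℚ) * ∑ M ∈ s, ξ M) - σ * ((Nat.card (CuspOrbits (Gamma0 N : Subgroup (GL (Fin 2) ℝ))) : ℚ) - 1) := by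
    have hr : (Module.finrank ℚ (LinearMap.range δ) : ℚ) = (Nat.card (CuspOrbits (Gamma0 N : Subgroup (GL (Fin 2) ℝ))) : ℚ) - 1 := by
      have : (Module.finrank ℚ (LinearMap.range δ) : ℚ) + 1 = Nat.card (CuspOrbits (Gamma0 N : Subgroup (GL (Fin 2) ℝ))) := by
        exact_mod_cast hrank
      linear_combination this
    rw [hstep1, hstep2, hstep3, hr] at hstep5
    linear_combination hstep5
  have hfinal : 2 * (LinearMap.trace ℂ _ Tn).re =
      ((((1 / 2 : ℚ) * ∑ M ∈ s, ξ M *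
          ((Finset.univ.filter fun q : Gamma0Coset N => actP N q (Matrix.adjugate M) = q).card : ℚ)) -
        ((1 / 2 : ℚ) * ∑ M ∈ s, ξ M) - σ * ((Nat.card (CuspOrbits (Gamma0 N : Subgroup (GL (Fin 2) ℝ))) : ℚ) - 1) : ℚ) : ℝ) := by
    rw [← hq, hstep4]
  rw [show (2 : ℂ) * (((LinearMap.trace ℂ _ Tn).re : ℝ) : ℂ) = ((2 * (LinearMap.trace ℂ _ Tn).re : ℝ) : ℂ) by
    push_cast; ring, hfinal, hσ]
  push_cast
  ring

end Assembly

end Literature.NumberTheory.EllipticCurves.ModularForms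

end
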